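import Summits.ResolutionOfSingularities.ResolutionOfSingularities.Theorems.NoPeriodicIsolatedAtom.Negative.FalseWithoutIsol
import Summits.ResolutionOfSingularities.ResolutionOfSingularities.Theorems.NoPeriodicIsolatedAtom.Negative.FalseWithoutMultP
import Summits.ResolutionOfSingularities.ResolutionOfSingularities.Theorems.NoPeriodicIsolatedAtom.Negative.FalseWithoutRpos

/-!
# Disproof of `NoPeriodicIsolatedAtom` — findings (crux stmt-ResolutionOfSingularities-16344,
# route `FrobeniusClosing`; crux-disprover seat, cycle 1, 2026-08-17)

**Verdict of this cycle: NO KILL, and none is expected — the crux resists because every regime in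
which a periodic isolated atom could live is closed by a structural argument that this seat
re-derived independently and checked on the exact calculus (toy mirror `toy/dyn.py`, this seat's
folder; numbers below).  The arguments, taken together, are a paper PROOF SKETCH of the crux (indeed
of the target `IsolatedForcedTermination`), recorded in §3 for the provers.**

The crux (`crux_iff` in `…Theorems.NoPeriodicIsolatedAtom.Negative.FalseWithoutIsol` displays it
over named operators, definitionally): for every prime `p`, `n ≥ 1`, field `κ` algebraic over `𝔽_p`,
start `c₀`, chart word `i`, translation word `t`, `r ≥ 1`: if the states `run 0 … run r` of the
point-blow-up dynamics of `z^p = a(u_1..u_n)` are all ISOLATED (`Isol`: `κ[[u]]/(∂a)` finite over `κ`)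
of MULTIPLICITY `p` (`MultP`: cleaned series non-zero, all monomials of degree `≥ p`), then
`¬ PairIso (run 0) (run r)` (`φ(a₀) = v^p a_r + g^p`, `φ` a `κ`-algebra automorphism of `κ[[u]]`,
`v` a unit).

## 1. Reading of the signature (elaborates, rc 0; no junk found)

* `bl i` is the total transform `u_j ↦ u_i u_j (j ≠ i)` (exponent `A ↦ (A_{-i}, |A|)`, guarded
  subtraction never truncates); `dv i s` divides by `u_i^s` with `s = p` exactly when the cleaned
  order is `≥ p` (always, under `MultP`); `tr i τ s` is the Taylor translation `u_j ↦ u_j + τ_j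
  (j ≠ i)` with the correct binomials `C(B_j + D_j, B_j) τ_j^{D_j}`, and its finite window
  `D_j ≤ B_i + s` loses nothing (a non-zero `c₃(B + D)` forces `Σ_{j≠i}(B_j + D_j) ≤ B_i + s`);
  `clean` deletes the monomials `u^{pA}` — over a perfect field exactly the coordinate change
  `z ↦ z − (Σ c_{pA}^{1/p} u^A)`; the constant term produced by a translation is such a monomial, so
  the `z`-shift to the new closed point is automatic.  `0 ^ 0 = 1` makes `τ = 0` the untranslated
  chart origin.  Checked against the toy mirror: umbrella fixed point, `n = 1` shifts, and 7 216
  random successor computations (T1 below).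
* `PairIso` quantifies over ALL `κ`-algebra automorphisms of `MvPowerSeries (Fin n) κ`; these are
  automatically local, hence `𝔪`-adically continuous, hence substitutions with invertible linear
  part — no wild automorphism makes `PairIso` cheap.  `Isol`, `MultP` (cleaned order) and the
  invariance rank `dL` are `PairIso`-invariants (`∂(v^p a' + g^p) = v^p ∂a'`, chain rule for `φ`;
  `ord(v^p a' + g^p) = ord a'` for cleaned `a'` because `g^p` only meets exponents in `pℕ^n`).
* Quantifier order matches the informal text; `t m (i m)` is ignored, as intended; no `Finset.sup ∅`,
  no `ℕ`-subtraction hazard (guarded), `sInf ∅ = 0` only reachable when `clean c = 0`, excluded by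
  `MultP`.

## 2. Load-bearing hypotheses (each dropped in turn)

* `Isol` — LOAD-BEARING, landed by the route-attack refuter:
  `Negative.FalseWithoutIsol.noPeriodicIsolatedAtom_false_without_Isol` (Whitney umbrella `x²y`,
  `p = 2, n = 2`, literal fixed point of chart `y`, `τ = 0`).  Re-exported below.
* `MultP` — LOAD-BEARING, NEW (this seat): `noPeriodicIsolatedAtom_false_without_MultP` below
  (LANDED as `Negative/FalseWithoutMultP.lean`, p153832, commit ff47fceb6535): the regular atom `z² = u` over `𝔽₂`, `n = 1`, is
  isolated (`jac = (1)`), has cleaned order `1 < p`, so the crux's `step` divides by `u_i^0` and — in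
  dimension 1, where `bl` and `tr` are identities — FIXES it; `PairIso` is reflexive.  Moral: below
  multiplicity `p` the inlined dynamics is junk (no division), so every use a proof makes of "the
  chain stays at multiplicity `p`" is genuine.
* `0 < r` — load-bearing for the trivial reason (`PairIso` reflexive at `r = 0`); the witness needs an
  isolated multiplicity-`p` atom with `Isol` actually VERIFIED: the cusp `z² = u³` over `𝔽₂`
  (`jac = (u²)`, `𝔽₂[[u]]/(u²)` finite via `MvPowerSeries.X_pow_dvd_iff`) —
  `noPeriodicIsolatedAtom_false_without_rpos` below (LANDED as `Negative/FalseWithoutRpos.lean`, p153875,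
  commit d436488cfa2b; `finite_quot_X_sq` there is a reusable pattern for the provers' `Isol` checks).
* `[Algebra.IsAlgebraic (ZMod p) κ]` — this seat could NOT make it bite and believes it is NOT
  load-bearing: every step of the proof sketch in §3 is formal (valid over any field of
  characteristic `p`, perfect or not — `Isol` is the Jacobian = non-smooth locus, which is what the
  arguments control).  INFORMATION FOR PROVERS/PLANNERS: the finite-field / closing-lemma philosophy
  of the route (items `BoundedMilnor`, `ClosingReduction`, `ClosingLemma`) is not needed for THIS
  item; the crux appears to be a theorem of the one-step cone geometry plus an arc lemma plus
  Lipman (n = 2), exactly the engine of the sibling route `WildCones`, reached here with two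
  simplifications (Koszul instead of Chern; splitting = suspension at `p = 2`).
* `p.Prime` — used (through `CharP`) in `∂(g^p) = 0` and in the binomial vanishing behind the cone
  analysis; dropping it changes the meaning of `clean`; not attacked.

## 3. Why it resists — regime by regime (this seat's independent derivation; toy-checked where noted)

Notation: a state of cleaned order `d`; `F_k` = degree-`k` part of the cleaned series; successor at
the `κ`-point `v = e_i + τ` of `E ≅ ℙ^{n-1}` in chart `i`; `H = {w_i = 0}`.

(3.0) UNWINDING (periodic ⇒ eternal).  A pair isomorphism `(φ, v, g) : a₀ → a_r` is the base part
of the `κ`-isomorphism `Ψ : κ[[u]][z]/(z^p − a₀) → κ[[u]][z]/(z^p − a_r)`, `u ↦ φ(u)`, `z ↦ vz + g`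
(`Ψ(z^p − a₀) = v^p (z^p − a_r)`).  `Ψ` lifts to the blow-ups; at corresponding closed points of the
exceptional divisors (`κ`-rational ↦ `κ`-rational, since `dφ(0) ∈ GL_n(κ)`), `φ'(u_i) = u_{i'}·unit`
and `g ∈ 𝔪 = (u_{i'})`, so `Ψ'(z/u_i) = v'·(z/u_{i'}) + g'` has the same shape and
`φ'(a₀⁺) = v'^p a_r⁺ + g'^p`: SUCCESSORS CORRESPOND UNDER `PairIso`, with `Isol`/`MultP` preserved.
Hence a periodic isolated chain continues for ever (dependent choice).  So the crux follows from
"no ETERNAL isolated multiplicity-`p` chain", over the same `κ`.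

(3.1) `n = 1`: the cleaned order drops by exactly `p` at every step; `PairIso` preserves it. TRUE.

(3.2) `n = 2`: an `Isol ∧ MultP` state is an isolated (hence normal) singular point of multiplicity
`p` of an excellent surface; its `Isol ∧ MultP` successor is a singular closed point of the point
blow-up at which the blow-up is normal, i.e. a point of Lipman's normalised blow-up; an eternal chain
contradicts Lipman 1978 (vendored: `Literature…Lipman1978SequenceFinite`).

(3.3) `n ≥ 3`, ORDER WINDOW: `d ≥ p + 2` ⇒ successor `∈ (u_i²)` ⇒ `jac ⊆ (u_i)`, not isolated;
`d = p + 1` ⇒ successor `= u_i f(u') + u_i² H̃` with `jac + (u_i) = (u_i, f)`, infinite colength for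
`n − 1 ≥ 2` unless `f(0) ≠ 0`, and then the degree-1 monomial `u_i` kills `MultP`.  So every
non-final state has `d = p` (= the route-review refuter's ARENA-SHARPENING = `stub_orderWindow`;
char-free).  Toy T1: 7 216 successor computations over `(p,n) ∈ {(3,3),(3,4),(2,3),(2,4),(5,3)}`,
prediction "MultP(successor) ⇔ v ∈ L(F_p) ∧ F_{p+k} vanishes to order ≥ p − k at v (1 ≤ k < p)"
agrees 7 216 / 7 216.

(3.4) `d = p`, SUCCESSOR CONDITIONS: `MultP` at `v` ⇔ `F_p(1, u'+τ) = F_p(v) + F_p(0,u')` and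
`F_{p+k}` vanishes to order `≥ p − k` at `v` (`1 ≤ k ≤ p−1`).  Writing `u = u_i v + w (w ∈ H)` the first
condition says `F_p = F_p|_H(w) + F_p(v) u_i^p`, hence `D_v F_p ≡ 0`: `v ∈ L := L(F_p)`, the
additive-invariance space, `d_L := dim L ≥ 1`; modulo additive `p`-th powers `F_p ≡ B(ℓ_1..ℓ_m)`,
a form on `V/L`, `m = n − d_L ≥ 2` (m = 1 would make `F_p` additive, cleaned to 0): ROOM `d_L ≤ n−2`.
The SINGULAR LOCUS of the blow-up on `E` near `v` is `V(jac⁺ + (u_i)) = {∇F_p = 0} ∩ {F_{p+1} = 0}`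
(by Euler, `∂_i F_p(v) = −Σ_{j≠i} v_j ∂_j F_p(v)`), i.e. `ℙ(N) ∩ {F_{p+1} = 0}` with
`N = ℓ⁻¹(N_B)`, `N_B = V(∂B)` the singular cone of `B`.

(3.5) `p` ODD, WIDE (`d_L ≥ 2`) ⇒ NO isolated multiplicity-`p` successor (= `WildCones.ConeExit`,
here by KOSZUL instead of Chern): if `V(∂_1 B, …, ∂_m B) = {0}` in `k̄^m` then the `∂_j B` are a
homogeneous regular sequence of degree `p − 1`, whose syzygies are generated (Koszul) in degree
`p − 1 ≥ 2`; but Euler `Σ s_j ∂_j B = pB = 0` is a non-zero syzygy of degree 1 — contradiction.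
So `N_B` contains a line, `N ⊇ M ⊋ L` with `M` linear of dimension `d_L + 1`, `v ∈ ℙ(L) ⊂ ℙ(M) ≅ ℙ^{d_L}`,
`F_{p+1}(v) = 0`, and `ℙ(M) ∩ {F_{p+1} = 0}` has local dimension `≥ d_L − 1 ≥ 1` at `v`:
`V(jac⁺) ⊇` a curve, `Isol` fails.  (At `p = 2` the Koszul step is void — `p − 1 = 1` — and indeed
`B = st` has `N_B = 0`: the contact-form exception.)  Toy T2 (`p = 3, n = 4`, `B = x²y`,
`a = x²y + x⁴ + y⁴ + z²w² + z⁵ + w⁷ (+ generic terms)`, successor at `e_w`): `MultP` holds and the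
colength of `jac⁺ + 𝔪^K` grows linearly in `K` (17, 23, 27, 30, 32, 34, 36, 38 for K = 4..11):
non-isolated, as predicted; the narrow control (`p = 3, n = 3`, same `B`) has an isolated successor
(μ⁺ = 14, stable) whose own chain dies one step later.  Toy T4 (the Koszul claim itself, "no form of degree p ≥ 3
in m ≥ 2 variables with ∇B ≢ 0 has an 𝔪-primary gradient ideal"): (p,m) = (3,2) 8/8, (3,3) 2 186/2 186, (5,2) 624/624
exhaustive over 𝔽_p, (3,4) 3 000, (5,3) 400, (7,2) 300 random — 0 exceptions; the p = 2 control finds the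
non-degenerate alternating forms (73/197 at m = 4), as it must.

(3.6) `p` ODD, NARROW (`d_L = 1`) ⇒ the successor is UNIQUE (`v = ℙ(L)`) and FREE: a next direction
`w' ∈ L(F_p⁺) ∩ H` would give `D_{w'}(F_p|_H) ≡ 0`, `w' ∈ L(B) = 0`.  So the chart index can be kept
constant and `a_m(s, u') = [a₀(s, γ_m(s) + s^m u') − G_m^p] / s^{pm}` with `γ_m → γ ∈ κ[[s]]^{n−1}`, a
smooth formal arc `Γ = {u' = γ(u_i)}`; `MultP` for all `m` forces the Taylor coefficients of `a₀`
along `Γ` to vanish in all `w`-degrees `1..p−1` and `a₀|_Γ ∈ κ[[s^p]]`, i.e. `a₀ ∈ e^p + I_Γ^p`,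
whence `jac(a₀) ⊆ I_Γ^{p−1} ⊆ I_Γ` — `Isol(a₀)` fails (= `WildCones.NarrowRunsDie`, for ALL `n`,
not only `2p ≥ n + 2`).

(3.7) `p = 2`, `n ≥ 3`: `F_2 = Σ_{j<k} q_{jk} u_j u_k` (no squares), `L = rad` of the alternating polar
form, `B` non-degenerate alternating on `V/L`, so `m = n − d_L` is EVEN and `N_B = 0`:
`d_L ≥ 3` ⇒ successor non-isolated (local dimension `≥ d_L − 2 ≥ 1`); `d_L ≤ 2` ⇒ after the formal
splitting `a ≃ x_1y_1 + … + x_ky_k + g(u'')` (hyperbolic pairs split in characteristic 2 as well: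
the IFT on `∂_x a = ∂_y a = 0` and the Artin–Schreier unit equation `μ² + μ = ε ∈ 𝔪` is Hensel),
every `MultP` successor has `v ∈ L = u''`-space, chart and translation inside `u''`, and
`(Σ x_jy_j + g)⁺ = Σ x_jy_j + g⁺` LITERALLY (the pairs pass through `bl/dv/tr/clean` unchanged):
the chain is the SUSPENSION of a chain of `g` in `d_L ≤ 2` variables — `d_L = 1`: order drops by 2
each step; `d_L = 2`: a surface chain, finite by (3.2).  Toy T3 (`p = 2, n = 4`, split and non-split
starts): successors keep `F_2 ∋ xy`, μ drops strictly (8→7→6→4→1, 7→6→4→1, 20→19), chains of length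
≤ 4, consistent with the spine card's char-2 runs (μ drops by a constant per forced step).

(3.8) Putting (3.0)–(3.7) together: no eternal isolated multiplicity-`p` chain exists for any
`(p, n, κ)`, hence no periodic one.  WHAT A COUNTEREXAMPLE WOULD HAVE TO BREAK: one of — the successor
correspondence (3.0); Lipman (3.2); the Koszul degree count (3.5, needs only `p ≥ 3`, `m ≥ 2`); the
free-arc bookkeeping (3.6); the char-2 splitting (3.7).  Each is classical or a two-line computation;
this seat found no gap.  The informative computation the route asked for (cycle search over
`𝔽_{p^m}`) is therefore predicted EMPTY in every cell, and the one regime the STRATEGY-CENSUS left to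
computation (p = 3, n = 4, rank 2, translations over 𝔽_9) is closed by (3.5) without computation.

## 4. Natural strengthenings (recorded so nobody files them)

* "the tangent cone class never recurs" — FALSE: at `p = 2` the split cone `xy` recurs at every step
  (T3); at `p = 3` narrow cones `G(u' − τu_i) − G(−τ)u_i^p` recur (census S3).
* "μ is non-increasing along isolated multiplicity-p steps" — FALSE at `p = 3, n = 4` (spine-card toy
  j004673: 9 → 12 at a verified forced step); TRUE-looking at `p = 2` (T3 and toy B), where it would
  follow from (3.7) + plane-curve theory.
* "no periodic atom over ARBITRARY fields of characteristic p" — believed TRUE (§2), i.e. NOT a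
  refutable strengthening; a prover may as well prove this form.

## 5. Targets

`payload.targets = []`, `stuck_stubs = []` (no line picked yet).  Read for the registered line
`ridge_rank`: `stub_orderWindow` = (3.3) TRUE char-free as stated (checked: the statement quantifies
over all fields `K`, and the argument uses no characteristic); `stub_dLmono` consistent with (3.4)
(`1 ≤ dL`, ROOM) — not attacked numerically beyond the strategist's 562/818; `stub_unwindQP` = (3.0)
TRUE; `stub_wideRecurrent` TRUE by (3.5) already at `m = 0, 1` (periodicity unused).  No stub of the
line is false or misstated as far as this seat can see.
-/

noncomputable section

-- single-problem summit: the doubled namespace component is forced by the tree layout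
set_option linter.dupNamespace false

namespace Summit.ResolutionOfSingularities.ResolutionOfSingularities.Cruxes.NoPeriodicIsolatedAtom.Disproof

open Summit.ResolutionOfSingularities.ResolutionOfSingularities.Theses.FrobeniusClosing (NoPeriodicIsolatedAtom)
open Summit.ResolutionOfSingularities.ResolutionOfSingularities.Theorems.NoPeriodicIsolatedAtom.Negative
open scoped BigOperators Classical

/-! ## (a) Load-bearing analysis as theorems -/

/-- `NoPeriodicIsolatedAtom` with the isolatedness conjunct `Isol` deleted (nothing else changed). -/
def NoPeriodicIsolatedAtomWithoutIsol : Prop :=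
  ∀ p : ℕ, p.Prime → ∀ n : ℕ, 0 < n → ∀ (κ : Type) [Field κ] [Algebra (ZMod p) κ] [Algebra.IsAlgebraic (ZMod p) κ]
    (c₀ : (Fin n → ℕ) → κ) (i : ℕ → Fin n) (t : ℕ → Fin n → κ) (r : ℕ), 0 < r →
    (∀ m, m ≤ r →
      ((∃ A, clean p (run p c₀ i t m) A ≠ 0) ∧
        ∀ A, clean p (run p c₀ i t m) A ≠ 0 → p ≤ Finset.sum Finset.univ (fun j => A j))) →
    ¬ ∃ (φ : MvPowerSeries (Fin n) κ ≃ₐ[κ] MvPowerSeries (Fin n) κ) (v g : MvPowerSeries (Fin n) κ),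
        IsUnit v ∧ φ (ser p (run p c₀ i t 0)) = v ^ p * ser p (run p c₀ i t r) + g ^ p

/-- **Any proof must use `Isol`** (landed: `Negative.FalseWithoutIsol`, refuter route-attack seat;
witness the Whitney umbrella `x²y` over `𝔽₂`, fixed by chart `y`, `τ = 0`). [cite: HauserPerlega2019, §1 p. 3] -/
theorem noPeriodicIsolatedAtom_false_without_Isol : ¬ NoPeriodicIsolatedAtomWithoutIsol :=
  _root_.Summit.ResolutionOfSingularities.ResolutionOfSingularities.Theorems.NoPeriodicIsolatedAtom.Negative.noPeriodicIsolatedAtom_false_without_Isol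

/-- `NoPeriodicIsolatedAtom` with the multiplicity conjunct `MultP` deleted (nothing else changed). -/
def NoPeriodicIsolatedAtomWithoutMultP : Prop :=
  ∀ p : ℕ, p.Prime → ∀ n : ℕ, 0 < n → ∀ (κ : Type) [Field κ] [Algebra (ZMod p) κ] [Algebra.IsAlgebraic (ZMod p) κ]
    (c₀ : (Fin n → ℕ) → κ) (i : ℕ → Fin n) (t : ℕ → Fin n → κ) (r : ℕ), 0 < r →
    (∀ m, m ≤ r → Module.Finite κ (MvPowerSeries (Fin n) κ ⧸ jac p (run p c₀ i t m))) →
    ¬ ∃ (φ : MvPowerSeries (Fin n) κ ≃ₐ[κ] MvPowerSeries (Fin n) κ) (v g : MvPowerSeries (Fin n) κ),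
        IsUnit v ∧ φ (ser p (run p c₀ i t 0)) = v ^ p * ser p (run p c₀ i t r) + g ^ p

/-- `NoPeriodicIsolatedAtom` with the binder `0 < r` deleted (nothing else changed). -/
def NoPeriodicIsolatedAtomWithoutRpos : Prop :=
  ∀ p : ℕ, p.Prime → ∀ n : ℕ, 0 < n → ∀ (κ : Type) [Field κ] [Algebra (ZMod p) κ] [Algebra.IsAlgebraic (ZMod p) κ]
    (c₀ : (Fin n → ℕ) → κ) (i : ℕ → Fin n) (t : ℕ → Fin n → κ) (r : ℕ),
    (∀ m, m ≤ r →
      Module.Finite κ (MvPowerSeries (Fin n) κ ⧸ jac p (run p c₀ i t m)) ∧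
      ((∃ A, clean p (run p c₀ i t m) A ≠ 0) ∧
        ∀ A, clean p (run p c₀ i t m) A ≠ 0 → p ≤ Finset.sum Finset.univ (fun j => A j))) →
    ¬ ∃ (φ : MvPowerSeries (Fin n) κ ≃ₐ[κ] MvPowerSeries (Fin n) κ) (v g : MvPowerSeries (Fin n) κ),
        IsUnit v ∧ φ (ser p (run p c₀ i t 0)) = v ^ p * ser p (run p c₀ i t r) + g ^ p

/-- **Any proof must use `MultP`** (this seat; LANDED as `Negative.FalseWithoutMultP`, p153832): the regular
atom `z² = u` over `𝔽₂` (`n = 1`) is isolated (`jac = (1)`), has cleaned order `1 < 2`, so the crux's step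
divides by `u ^ 0` and fixes it; `PairIso` is reflexive. [cite: HauserPerlega2019, §2] -/
theorem noPeriodicIsolatedAtom_false_without_MultP : ¬ NoPeriodicIsolatedAtomWithoutMultP :=
  _root_.Summit.ResolutionOfSingularities.ResolutionOfSingularities.Theorems.NoPeriodicIsolatedAtom.Negative.noPeriodicIsolatedAtom_false_without_MultP

/-- **`0 < r` cannot be dropped** (this seat; LANDED as `Negative.FalseWithoutRpos`, p153875): at `r = 0` the
conclusion fails by reflexivity of `PairIso` at the isolated multiplicity-2 cusp atom `z² = u³` over `𝔽₂`
(`n = 1`; `jac = (u²)`, `𝔽₂[[u]]/(u²)` finite — `Negative.finite_quot_X_sq`). [folklore] -/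
theorem noPeriodicIsolatedAtom_false_without_rpos : ¬ NoPeriodicIsolatedAtomWithoutRpos :=
  _root_.Summit.ResolutionOfSingularities.ResolutionOfSingularities.Theorems.NoPeriodicIsolatedAtom.Negative.noPeriodicIsolatedAtom_false_without_rpos

/-! ## (b)/(c) Tightness and natural strengthenings

Recorded in the module docstring §4 (cone recurrence FALSE; μ-monotonicity FALSE at p = 3, n = 4;
the all-fields form believed TRUE).  None is formalised: the first two need a multi-monomial
4-variable step through `tr`, whose bookkeeping (≈ 150 lines per monomial, cf. `FalseWithoutIsol`)
buys the provers nothing they do not already read off §3.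

## (d) Targets

None served (`payload.targets = []`).

## (e) Near-misses

None: no attack came close to a periodic isolated atom; §3 explains why none can. -/

end Summit.ResolutionOfSingularities.ResolutionOfSingularities.Cruxes.NoPeriodicIsolatedAtom.Disproof

end
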